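import Summits.Ventures.CertifiedManyBodySolver.Rows.CorrWindowCertDictionaryEnergy
import Summits.Ventures.CertifiedManyBodySolver.Observables.StiffnessTLOddMomentOrbitRowTT
import HarnessLib

/-!
# DICTIONARY for the kernel form of the window-certificate soundness: the f-SUM OBJECTIVE WORD `−X₀(t′, U)` of the La214 / Hg-1201 / NdNiO₂
# stiffness certificates as a syntactic term list over indexed site letters (`termOp_fsumTermsIdx`)

HONEST FRAMING: Lean plumbing towards «tier P» (no claim node discharged, no number); the rows this serves are CONTROL/CALIBRATION
stiffness-scale CEILINGS (wording (xx1)), silent on the presence of superconductivity; not a `T_c` or phase sentence; no summit statement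
is proved by this file. Seat hubbard-cov-la214-unc-2 g6 (`prover-hubbard-cov-la214-unc-2-g5-0`), zero compute; companion of hubbard-obs-p2's
`Rows/CorrWindowCertDictionaries.lean` (`termOp_hamTermsIdx`, the window Hamiltonian) and `Rows/CorrWindowCertDictionaryEnergy.lean`
(`termOp_energyTermsIdx`, the embedded mean-energy observable).

WHY. The literal-free tier-P closers `Theorems/CovLa214M2bItemsOfKernelPairs.lean` (p670443) and the pair kernel form
`SquareTTPrimePinnedPairRowT.of_kernelCerts{,_sos}` (p668982) ask, per vertex, for THREE dictionary equalities: `hH_v` (window Hamiltonian),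
`hE_v` (mean energy) — both discharged by hubbard-obs-p2's theorems — and the OBJECTIVE `hX_v : termOp d TX_v = −oddMomentObsTT s_v U 0` (own f-sum
word of the vertex at `t′ = s_v`) or `= −oddMomentObsTT (−3/10) U 0` (corner objective). This file supplies the third: the canonical THREE-BOND list
`fsumTermsIdx tp ix = bond(e₁, 0; −½) + Σ_s bond(j_s, 0; −tp/2)` (hubbard-obs-p2's `bondT`; `j_s` the two diagonal steps) and
`termOp_fsumTermsIdx : termOp d (fsumTermsIdx tp ix) = −oddMomentObsTT tp U 0` on the letters of `Λ₇ = box 2 7` (any `U`: at `λ = 0` the `λ`-terms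
of `X_λ` carry the factors `0` and `0²/2`, so `X₀ = ½ Γ(k₀ + tp Σ_s Σ_σ (c†_{j_s σ} c_{0σ} + h.c.))`). An exporter emits `TX_v := fsumTermsIdx s_v ix`
verbatim and cites this theorem. Everything is PROVED (0 sorry); the one `def` is a list program.

References: T. Koma, H. Tasaki, J. Stat. Phys. 76 (1994) 745 §1 [KomaTasaki1994]; D. J. Scalapino, S. R. White, S.-C. Zhang, PRB 47 (1993) 7995
§II (the kinetic bond word of the f-sum rule) [ScalapinoWhiteZhang1993]; E. Lipparini, *Modern Many-Particle Physics* (2008) eq. (8.30) [Lipparini2008].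
-/

noncomputable section

namespace Summit.Ventures.CertifiedManyBodySolver

namespace CARPolyWindow

open Summit.Ventures.CertifiedQuantumChemistry Summit.Ventures.CertifiedQuantumChemistry.CARPoly
open Literature.MathematicalPhysics.QuantumLattice Literature.MathematicalPhysics.QuantumLattice.HubbardWave0
open Literature.Probability.LatticeModels
open Summit.Ventures.CertifiedManyBodySolver.Observables
open Matrix
open scoped ComplexOrder BigOperators

/-! ## Syntax -/

section Syntax

variable {N : ℕ}

/-- **The f-sum objective word `−X₀(tp)` as a term list** (index reader `ix : ℤ² → Fin N`): `bond(e₁, 0; −½) + Σ_s bond(j_s, 0; −tp/2)`, i.e.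
`−½ Σ_σ (a†_{e₁σ}a_{0σ} + a†_{0σ}a_{e₁σ}) − (tp/2) Σ_s Σ_σ (a†_{j_sσ}a_{0σ} + a†_{0σ}a_{j_sσ})`. [cite: ScalapinoWhiteZhang1993, §II] -/
def fsumTermsIdx (tp : ℚ) (ix : Site 2 → Fin N) : Terms (Orb (Fin N)) :=
  bondT (ix (unitVec 0)) (ix 0) (-1 / 2) ++ (finL 2).flatMap fun s : Fin 2 => bondT (ix (diagVec s)) (ix 0) (-tp / 2)

end Syntax

/-! ## The dictionary theorem -/

section Dictionary

variable {N : ℕ}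

/-- Membership-proof irrelevance for ordered sites. [folklore] -/
private theorem pt_congr_site' {Λ' : Finset (Site 2)} {x y : Site 2} (hx : x ∈ Λ') (hy : y ∈ Λ') (h : x = y) :
    PolySite.pt x hx = PolySite.pt y hy := by
  subst h; rfl

/-- **DICTIONARY: the indexed three-bond list IS the f-sum objective word at `λ = 0`.** For an enumeration `xs : Fin N → ℤ²` of sites of
`Λ₇ = box 2 7`, the letter map `d (i, σ) = (xs i, σ)` and an index reader `ix` with `xs (ix v) = v` on `box 2 1`:
`termOp d (fsumTermsIdx tp ix) = −oddMomentObsTT tp U 0` (every `U`). [cite: ScalapinoWhiteZhang1993, §II] [cite: Lipparini2008, eq. (8.30)] -/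
theorem termOp_fsumTermsIdx (tp : ℚ) (U : ℝ) (xs : Fin N → Site 2) (hmem : ∀ i, xs i ∈ box 2 7) (ix : Site 2 → Fin N)
    (hix : ∀ v ∈ box 2 1, xs (ix v) = v)
    (d : Orb (Fin N) → Orb (PolySite (box 2 7))) (hd : ∀ i σ, d (orb i σ) = orb (PolySite.pt (xs i) (hmem i)) σ) :
    termOp d (fsumTermsIdx tp ix) = -oddMomentObsTT (tp : ℝ) U 0 := by
  -- the indexed orbitals and membership-proof irrelevance on `box 2 1`
  set P : Site 2 → PolySite (box 2 7) := fun v => PolySite.pt (xs (ix v)) (hmem (ix v)) with hP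
  have h17 : box 2 1 ⊆ box 2 7 := box_subset_box (by norm_num)
  have hpt : ∀ (v : Site 2) (hv : v ∈ box 2 1) (hv' : v ∈ box 2 7), PolySite.pt v hv' = P v := by
    intro v hv hv'
    exact pt_congr_site' hv' (hmem (ix v)) (hix v hv).symm
  -- (1) the syntactic side
  have hL : termOp d (fsumTermsIdx tp ix) =
      (((-1 / 2 : ℚ)) : ℂ) • ∑ σ : Fin 2,
          (creation (orb (P (unitVec 0)) σ) * annihilation (orb (P 0) σ) + creation (orb (P 0) σ) * annihilation (orb (P (unitVec 0)) σ)) +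
        ∑ s : Fin 2, (((-tp / 2 : ℚ)) : ℂ) • ∑ σ : Fin 2,
          (creation (orb (P (diagVec s)) σ) * annihilation (orb (P 0) σ) + creation (orb (P 0) σ) * annihilation (orb (P (diagVec s)) σ)) := by
    rw [fsumTermsIdx, termOp_append, termOp_bondT xs hmem d hd, termOp_flatMap_finL]
    refine congrArg _ (Finset.sum_congr rfl fun s _ => ?_)
    rw [termOp_bondT xs hmem d hd]
  -- (2) the semantic side: `X₀ = ½ Γ(kinBondObsTT tp)`, then the bonds in creation/annihilation form
  have hbond : ∀ (x : Site 2) (hx : x ∈ box 2 1) (σ : Fin 2),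
      fermionEmbed (PolySite.incl h17) ((cAt x hx σ)ᴴ * cAt 0 zero_mem_box_one σ + (cAt 0 zero_mem_box_one σ)ᴴ * cAt x hx σ) =
        creation (orb (P x) σ) * annihilation (orb (P 0) σ) + creation (orb (P 0) σ) * annihilation (orb (P x) σ) := by
    intro x hx σ
    rw [map_add, map_mul, map_mul, fermionEmbed_conjTranspose, fermionEmbed_conjTranspose, fermionEmbed_incl_cAt,
      fermionEmbed_incl_cAt, cAt, cAt, annihilation_conjTranspose, annihilation_conjTranspose, hpt x hx, hpt 0 zero_mem_box_one]
  have hbond1 : ∀ σ : Fin 2,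
      fermionEmbed (PolySite.incl h17) ((cAt (unitVec 0) unitVec_zero_mem_box_one σ)ᴴ * cAt 0 zero_mem_box_one σ +
          (cAt 0 zero_mem_box_one σ)ᴴ * cAt (unitVec 0) unitVec_zero_mem_box_one σ) =
        creation (orb (P (unitVec 0)) σ) * annihilation (orb (P 0) σ) + creation (orb (P 0) σ) * annihilation (orb (P (unitVec 0)) σ) :=
    fun σ => hbond (unitVec 0) unitVec_zero_mem_box_one σ
  have hbond2 : ∀ (s σ : Fin 2),
      fermionEmbed (PolySite.incl h17) ((cAt (diagVec s) (diagVec_mem_box_one s) σ)ᴴ * cAt 0 zero_mem_box_one σ +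
          (cAt 0 zero_mem_box_one σ)ᴴ * cAt (diagVec s) (diagVec_mem_box_one s) σ) =
        creation (orb (P (diagVec s)) σ) * annihilation (orb (P 0) σ) + creation (orb (P 0) σ) * annihilation (orb (P (diagVec s)) σ) :=
    fun s σ => hbond (diagVec s) (diagVec_mem_box_one s) σ
  have hX0 : oddMomentObsTT ((tp : ℚ) : ℝ) U 0 =
      (((1 / 2 : ℝ)) : ℂ) • fermionEmbed (PolySite.incl h17) (kinBondObsTT ((tp : ℚ) : ℝ)) := by
    unfold oddMomentObsTT
    simp only [Complex.ofReal_zero, zero_smul, add_zero, ne_eq, OfNat.ofNat_ne_zero, not_false_eq_true, zero_pow, zero_div,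
      sub_zero]
  have hk : fermionEmbed (PolySite.incl h17) (kinBondObsTT ((tp : ℚ) : ℝ)) =
      ∑ σ : Fin 2, (creation (orb (P (unitVec 0)) σ) * annihilation (orb (P 0) σ) +
          creation (orb (P 0) σ) * annihilation (orb (P (unitVec 0)) σ)) +
        ((((tp : ℚ) : ℝ) : ℝ) : ℂ) • ∑ s : Fin 2, ∑ σ : Fin 2,
          (creation (orb (P (diagVec s)) σ) * annihilation (orb (P 0) σ) + creation (orb (P 0) σ) * annihilation (orb (P (diagVec s)) σ)) := by
    unfold kinBondObsTT kinBondObs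
    rw [map_add, map_sum, map_smul, map_sum]
    simp_rw [map_sum, hbond1, hbond2]
  have hR : -oddMomentObsTT (tp : ℝ) U 0 =
      (((-1 / 2 : ℚ)) : ℂ) • ∑ σ : Fin 2,
          (creation (orb (P (unitVec 0)) σ) * annihilation (orb (P 0) σ) + creation (orb (P 0) σ) * annihilation (orb (P (unitVec 0)) σ)) +
        ∑ s : Fin 2, (((-tp / 2 : ℚ)) : ℂ) • ∑ σ : Fin 2,
          (creation (orb (P (diagVec s)) σ) * annihilation (orb (P 0) σ) + creation (orb (P 0) σ) * annihilation (orb (P (diagVec s)) σ)) := by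
    have ec1 : -(((1 / 2 : ℝ)) : ℂ) = (((-1 / 2 : ℚ)) : ℂ) := by push_cast; ring
    have ec2 : -((((1 / 2 : ℝ)) : ℂ) * ((((tp : ℚ) : ℝ) : ℝ) : ℂ)) = (((-tp / 2 : ℚ)) : ℂ) := by push_cast; ring
    rw [hX0, hk, smul_add, smul_smul, neg_add, ← neg_smul, ← neg_smul, ec1, ec2, Finset.smul_sum, Finset.smul_sum]
  rw [hL, hR]

end Dictionary

end CARPolyWindow

end Summit.Ventures.CertifiedManyBodySolver

end
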